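import Summits.ValiantsHypothesis.ValiantsHypothesis.Theorems.BarrierLeverChowBenchmarkPairsSplitCertEntry
import Summits.ValiantsHypothesis.ValiantsHypothesis.Theorems.BarrierLeverPartitionMinorsMooreBenchRows

/-!
# Route BarrierLever — item 22038 `ChowBenchmarkPairs`, line `moore-peel`: TRANSLATION INVARIANCE of Dirichlet-weighted segment
# matrices on initial segments of the binary codes (the bridge between the homogeneous picture and the line's statements)

Helper file (`--supports stmt-ValiantsHypothesis-22038`; cell valiant-natproofs, rung V4; seat val-np-p4 gen 24).  Closes NO item.

The split numerics and the split certificates (`…SplitCertHomog`) live in the HOMOGENEOUS picture — the origin is a free point `P_0` —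
while the line's `SegmentMeanValueAt h` / CONJECTURE HAAR pin the origin at `0`.  The two are equivalent because the row functionals
(Dirichlet means of monomials over segments) transform under a common translation `P ↦ P + v` of all points by a UNITRIANGULAR change of
the monomial basis, as long as (i) all rows have the same total weight `|w|` and (ii) the columns form a down-set (every subset of a
column is a column) — true for the first `r ≤ 2^h` binary codes (`MoorePeel.benchCols_downClosed`).  This file proves it in the kernel:

* `sum_weight_raise` — the PÓLYA IDENTITY `Σ_{a∈S} w_a · dirE P S (w+δ_a) T = (|w| + |T|) · dirE P S w T`;
* `dirE_shiftT` — the TRANSLATION EXPANSION `dirE (P+v) S w T = Σ_{A⊆T} v^{T∖A} (|w|+|A|)^{(|T|−|A|)} dirE P S w A` (induction on `T`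
  by the one-coordinate expansion `dirE_insert` of `…ChowBenchmarkPairsSplit` and the Pólya identity);
* `matrix_shiftT` / `det_shiftU` / **`det_shiftT`** — on the columns `benchCols h r` (`r ≤ 2^h`) and for rows of constant total weight,
  translating the table multiplies the matrix on the right by the upper unitriangular `shiftU`, so THE DETERMINANT IS TRANSLATION INVARIANT.

WHAT THIS IS NOT: no stub of the line is closed; nothing on crux stmt-ValiantsHypothesis-14610 or on `VP` versus `VNP`.
-/

set_option linter.dupNamespace false
set_option autoImplicit false

namespace Summit.ValiantsHypothesis.ValiantsHypothesis.Theorems.BarrierLever.ChowBenchmarkSplit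

open Finset
open Summit.ValiantsHypothesis.ValiantsHypothesis.Theorems.BarrierLever.MoorePeel
  (benchCols bin bits bin_bits bits_bin map_benchCols benchCols_bin bin_le_bin_of_subset bin_map_lt_two_pow benchCols_injective)

variable {κ : Type*} [DecidableEq κ] {R : Type*} [CommRing R] {π : Type*} [DecidableEq π]

/-! ## 1. The Pólya identity: raising one weight at a time -/

omit [DecidableEq κ] in
/-- Fibre sizes of a map `g : T → S` add up to `|T|`. -/
theorem sum_card_fiber {S : Finset π} {T : Finset κ} (g : ↥T → ↥S) :
    ∑ b : ↥S, (Finset.univ.filter fun c : ↥T => g c = b).card = T.card := by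
  rw [← Finset.card_eq_sum_card_fiberwise (f := g) (s := Finset.univ) (t := Finset.univ) (fun _ _ => Finset.mem_univ _),
    Finset.card_univ, Fintype.card_coe]

omit [DecidableEq κ] in
/-- The weight product with ONE weight raised, against the plain one (natural numbers). -/
theorem weight_raise_nat {S : Finset π} {T : Finset κ} (w : π → ℕ) (g : ↥T → ↥S) (a : ↥S) :
    w a * ∏ b : ↥S, (Function.update w (a : π) (w a + 1) b).ascFactorial (Finset.univ.filter fun c : ↥T => g c = b).card =
      (w a + (Finset.univ.filter fun c : ↥T => g c = a).card) *
        ∏ b : ↥S, (w b).ascFactorial (Finset.univ.filter fun c : ↥T => g c = b).card := by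
  rw [← Finset.mul_prod_erase Finset.univ _ (Finset.mem_univ a), ← Finset.mul_prod_erase Finset.univ _ (Finset.mem_univ a),
    Function.update_self]
  have hrest : ∏ b ∈ Finset.univ.erase a, (Function.update w (a : π) (w a + 1) b).ascFactorial
      (Finset.univ.filter fun c : ↥T => g c = b).card =
      ∏ b ∈ Finset.univ.erase a, (w b).ascFactorial (Finset.univ.filter fun c : ↥T => g c = b).card := by
    refine Finset.prod_congr rfl fun b hb => ?_
    have hne : (b : π) ≠ (a : π) := fun e => (Finset.ne_of_mem_erase hb) (Subtype.ext e)
    rw [Function.update_of_ne hne]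
  rw [hrest, ← mul_assoc, ← mul_assoc, Nat.succ_ascFactorial]

/-- **PÓLYA IDENTITY.**  `Σ_{a∈S} w_a · dirE P S (w + δ_a) T = (|w| + |T|) · dirE P S w T` (`|w| = Σ_{a∈S} w_a`): mixing the
Dirichlet(`w + δ_a`) means with weights `w_a/|w|` gives the Dirichlet(`w`) mean (the first draw of a Pólya urn). -/
theorem sum_weight_raise (P : π → κ → R) (S : Finset π) (w : π → ℕ) (T : Finset κ) :
    ∑ a ∈ S, (w a : R) * dirE P S (Function.update w a (w a + 1)) T = ((S.sum w + T.card : ℕ) : R) * dirE P S w T := by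
  classical
  unfold dirE
  rw [Finset.mul_sum]
  simp_rw [Finset.mul_sum]
  rw [Finset.sum_comm]
  refine Finset.sum_congr rfl fun g _ => ?_
  -- per function `g`
  rw [← Finset.sum_coe_sort S]
  have key : ∀ a : ↥S, (w a : R) * ((∏ c : ↥T, P (g c) c) *
      ∏ b : ↥S, (((Function.update w (a : π) (w a + 1) b).ascFactorial (Finset.univ.filter fun c : ↥T => g c = b).card : ℕ) : R)) =
      ((w a + (Finset.univ.filter fun c : ↥T => g c = a).card : ℕ) : R) *
        ((∏ c : ↥T, P (g c) c) * ∏ b : ↥S, (((w b).ascFactorial (Finset.univ.filter fun c : ↥T => g c = b).card : ℕ) : R)) := by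
    intro a
    have h := congrArg (fun n : ℕ => (n : R)) (weight_raise_nat (T := T) w g a)
    simp only [Nat.cast_mul, Nat.cast_prod] at h
    rw [mul_left_comm, ← Nat.cast_prod, ← Nat.cast_mul, weight_raise_nat w g a, Nat.cast_mul, Nat.cast_prod, mul_left_comm]
  rw [Finset.sum_congr rfl fun a _ => key a, ← Finset.sum_mul]
  congr 1
  rw [← Nat.cast_sum, Finset.sum_add_distrib, sum_card_fiber g, Finset.sum_coe_sort S w]


/-! ## 2. Translating all points: the column expansion -/

/-- The table with every point translated by `v`. -/
def shiftT (P : π → κ → R) (v : κ → R) : π → κ → R := fun a c => P a c + v c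

/-- Raising a weight at a point of `S` raises the total weight by one. -/
theorem sum_update_succ {S : Finset π} (w : π → ℕ) {a : π} (ha : a ∈ S) :
    S.sum (Function.update w a (w a + 1)) = S.sum w + 1 := by
  rw [Finset.sum_update_of_mem ha, Finset.sdiff_singleton_eq_erase, ← Finset.add_sum_erase S w ha]
  ring

/-- **TRANSLATION EXPANSION.**  For every column `T` and weight `w`:
`dirE (P + v) S w T = Σ_{A ⊆ T} v^{T∖A} · (|w| + |A|)^{(|T|−|A|)} · dirE P S w A` — the Dirichlet mean of the translated monomial
`(z + v)^T = Σ_A v^{T∖A} z^A`, with the normalisations `dirE = |w|^{(|T|)} ×` mean.  Proof: induction on `T` by the one-coordinate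
expansion `dirE_insert` and the Pólya identity `sum_weight_raise`. -/
theorem dirE_shiftT (P : π → κ → R) (v : κ → R) (S : Finset π) :
    ∀ (T : Finset κ) (w : π → ℕ), dirE (shiftT P v) S w T =
      ∑ A ∈ T.powerset, (∏ c ∈ T \ A, v c) * (((S.sum w + A.card).ascFactorial (T.card - A.card) : ℕ) : R) * dirE P S w A := by
  classical
  intro T
  induction T using Finset.induction_on with
  | empty =>
    intro w
    simp [Cert.dirE_empty_col]
  | @insert c T hc ih =>
    intro w
    have step : ∀ a : ↥S, ((w a : R) * shiftT P v a c * dirE (shiftT P v) S (Function.update w (a : π) (w a + 1)) T) =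
        (w a : R) * P a c * (∑ A ∈ T.powerset, (∏ c ∈ T \ A, v c) *
            (((S.sum w + 1 + A.card).ascFactorial (T.card - A.card) : ℕ) : R) * dirE P S (Function.update w (a : π) (w a + 1)) A) +
        v c * ((w a : R) * ∑ A ∈ T.powerset, (∏ c ∈ T \ A, v c) *
            (((S.sum w + 1 + A.card).ascFactorial (T.card - A.card) : ℕ) : R) * dirE P S (Function.update w (a : π) (w a + 1)) A) := by
      intro a
      rw [ih (Function.update w (a : π) (w a + 1)), sum_update_succ w a.2, shiftT]
      ring
    rw [dirE_insert S _ _ hc, Finset.sum_powerset_insert hc, Fintype.sum_congr _ _ step, Finset.sum_add_distrib, add_comm]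
    congr 1
    · -- the `v`-part: columns `A ⊆ T`; Pólya identity
      have hf : ∀ A ∈ T.powerset, (∏ c' ∈ insert c T \ A, v c') *
            (((S.sum w + A.card).ascFactorial ((insert c T).card - A.card) : ℕ) : R) * dirE P S w A =
          v c * ((∏ c' ∈ T \ A, v c') * ((((S.sum w + T.card) * (S.sum w + A.card).ascFactorial (T.card - A.card) : ℕ)) : R) *
            dirE P S w A) := by
        intro A hA
        have hAT : A ⊆ T := Finset.mem_powerset.mp hA
        have e1 : insert c T \ A = insert c (T \ A) := by
          ext x; simp only [Finset.mem_sdiff, Finset.mem_insert]; constructor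
          · rintro ⟨h1 | h1, h2⟩
            · exact Or.inl h1
            · exact Or.inr ⟨h1, h2⟩
          · rintro (h1 | ⟨h1, h2⟩)
            · exact ⟨Or.inl h1, fun h3 => hc (h1 ▸ hAT h3)⟩
            · exact ⟨Or.inr h1, h2⟩
        have hcTA : c ∉ T \ A := fun h => hc (Finset.mem_sdiff.mp h).1
        have e2 : (insert c T).card - A.card = T.card - A.card + 1 := by
          rw [Finset.card_insert_of_notMem hc]
          have := Finset.card_le_card hAT
          omega
        have e4 : (S.sum w + A.card).ascFactorial (T.card - A.card + 1) =
            (S.sum w + T.card) * (S.sum w + A.card).ascFactorial (T.card - A.card) := by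
          rw [Nat.ascFactorial_succ]
          have := Finset.card_le_card hAT
          congr 1; omega
        rw [e1, Finset.prod_insert hcTA, e2, e4]
        ring
      rw [Finset.sum_congr rfl hf, ← Finset.mul_sum, ← Finset.mul_sum]
      congr 1
      simp_rw [Finset.mul_sum]
      rw [Finset.sum_comm]
      refine Finset.sum_congr rfl fun A hA => ?_
      have hp := sum_weight_raise P S w A
      rw [← Finset.sum_coe_sort S] at hp
      have e3 : ∑ a : ↥S, (w a : R) * ((∏ c ∈ T \ A, v c) *
          (((S.sum w + 1 + A.card).ascFactorial (T.card - A.card) : ℕ) : R) *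
            dirE P S (Function.update w (a : π) (w a + 1)) A) =
          (∏ c ∈ T \ A, v c) * (((S.sum w + 1 + A.card).ascFactorial (T.card - A.card) : ℕ) : R) *
            ∑ a : ↥S, (w a : R) * dirE P S (Function.update w (a : π) (w a + 1)) A := by
        rw [Finset.mul_sum]
        refine Finset.sum_congr rfl fun a _ => ?_
        ring
      rw [e3, hp]
      have e5 : (S.sum w + T.card) * (S.sum w + A.card).ascFactorial (T.card - A.card) =
          (S.sum w + A.card) * (S.sum w + 1 + A.card).ascFactorial (T.card - A.card) := by
        rw [show S.sum w + 1 + A.card = (S.sum w + A.card).succ by omega, Nat.succ_ascFactorial]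
        have := Finset.card_le_card (Finset.mem_powerset.mp hA)
        congr 1; omega
      rw [e5]
      push_cast
      ring
    · -- the `P`-part: columns `insert c A`
      simp_rw [Finset.mul_sum]
      rw [Finset.sum_comm]
      refine Finset.sum_congr rfl fun A hA => ?_
      have hAT : A ⊆ T := Finset.mem_powerset.mp hA
      have hcA : c ∉ A := fun h => hc (hAT h)
      have e1 : insert c T \ insert c A = T \ A := by
        ext x; simp only [Finset.mem_sdiff, Finset.mem_insert]; constructor
        · rintro ⟨h1 | h1, h2⟩
          · exact absurd (Or.inl h1) h2
          · exact ⟨h1, fun h3 => h2 (Or.inr h3)⟩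
        · rintro ⟨h1, h2⟩; exact ⟨Or.inr h1, fun h3 => h3.elim (fun e => hc (e ▸ h1)) h2⟩
      have e2 : (insert c T).card - (insert c A).card = T.card - A.card := by
        rw [Finset.card_insert_of_notMem hc, Finset.card_insert_of_notMem hcA]; omega
      rw [e1, e2, Finset.card_insert_of_notMem hcA, dirE_insert S _ _ hcA, Finset.mul_sum]
      refine Finset.sum_congr rfl fun a _ => ?_
      rw [show S.sum w + 1 + A.card = S.sum w + (A.card + 1) by ring]
      ring


/-! ## 3. The matrix on an initial segment of the binary codes: translation = right multiplication by a unitriangular matrix -/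

section Codes

variable {h r : ℕ}

/-- `i ≤ j` when the bits of `i` are among the bits of `j` (`i, j < 2^h`). -/
theorem le_of_benchCols_subset (hr : r ≤ 2 ^ h) {i j : Fin r} (hij : benchCols h r i ⊆ benchCols h r j) : i ≤ j := by
  have hi : (i : ℕ) < 2 ^ h := lt_of_lt_of_le i.2 hr
  have hj : (j : ℕ) < 2 ^ h := lt_of_lt_of_le j.2 hr
  have := bin_le_bin_of_subset (s := (benchCols h r i).map Fin.valEmbedding) (t := (benchCols h r j).map Fin.valEmbedding)
    (Finset.map_subset_map.mpr hij)
  rw [map_benchCols i hi, map_benchCols j hj, bin_bits, bin_bits] at this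
  exact this

/-- **The translation matrix** `U_{j'j} = [bits j' ⊆ bits j] · v^{bits j ∖ bits j'} · (W + |bits j'|)^{(|bits j| − |bits j'|)}`. -/
def shiftU (h r : ℕ) (v : Fin h → R) (W : ℕ) : Matrix (Fin r) (Fin r) R :=
  Matrix.of fun j' j => if benchCols h r j' ⊆ benchCols h r j then
    (∏ c ∈ benchCols h r j \ benchCols h r j', v c) *
      (((W + (benchCols h r j').card).ascFactorial ((benchCols h r j).card - (benchCols h r j').card) : ℕ) : R)
    else 0

/-- The translation matrix is upper unitriangular in code order, so its determinant is `1`. -/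
theorem det_shiftU (hr : r ≤ 2 ^ h) (v : Fin h → R) (W : ℕ) : (shiftU h r v W).det = 1 := by
  have hBT : (shiftU h r v W).BlockTriangular id := by
    intro i j hij
    simp only [id] at hij
    rw [shiftU, Matrix.of_apply, if_neg]
    intro hsub
    exact absurd (le_of_benchCols_subset hr hsub) (not_le.mpr hij)
  rw [Matrix.det_of_upperTriangular hBT]
  refine Finset.prod_eq_one fun j _ => ?_
  rw [shiftU, Matrix.of_apply, if_pos (Finset.Subset.refl _), Finset.sdiff_self, Finset.prod_empty, Nat.sub_self,
    Nat.ascFactorial_zero, Nat.cast_one, mul_one]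

/-- **TRANSLATION = RIGHT MULTIPLICATION BY `U`** for a weighted row family of CONSTANT total weight `W` on the first `r ≤ 2^h` binary
codes (a down-set of columns). -/
theorem matrix_shiftT (hr : r ≤ 2 ^ h) {ι : Type*} [Fintype ι] (P : π → Fin h → R) (v : Fin h → R) (S : ι → Finset π)
    (w : ι → π → ℕ) (W : ℕ) (hW : ∀ i, (S i).sum (w i) = W) :
    (Matrix.of fun i j => dirE (shiftT P v) (S i) (w i) (benchCols h r j)) =
      (Matrix.of fun i j => dirE P (S i) (w i) (benchCols h r j)) * shiftU h r v W := by
  classical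
  refine Matrix.ext fun i j => ?_
  rw [Matrix.mul_apply, Matrix.of_apply, dirE_shiftT]
  simp only [Matrix.of_apply, shiftU]
  simp_rw [mul_ite, mul_zero]
  rw [← Finset.sum_filter]
  symm
  refine Finset.sum_bij (fun j' _ => benchCols h r j') ?_ ?_ ?_ ?_
  · intro j' hj'
    exact Finset.mem_powerset.mpr (Finset.mem_filter.mp hj').2
  · intro j₁ _ j₂ _ e
    exact benchCols_injective hr e
  · intro A hA
    obtain ⟨j', hj'⟩ := MoorePeel.benchCols_downClosed hr j A (Finset.mem_powerset.mp hA)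
    exact ⟨j', Finset.mem_filter.mpr ⟨Finset.mem_univ _, hj' ▸ Finset.mem_powerset.mp hA⟩, hj'⟩
  · intro j' _
    rw [hW i]
    ring

/-- **TRANSLATION INVARIANCE OF THE DETERMINANT** (constant total weight, columns = first `r ≤ 2^h` codes). -/
theorem det_shiftT (hr : r ≤ 2 ^ h) (P : π → Fin h → R) (v : Fin h → R) (S : Fin r → Finset π) (w : Fin r → π → ℕ)
    (W : ℕ) (hW : ∀ i, (S i).sum (w i) = W) :
    (Matrix.of fun i j : Fin r => dirE (shiftT P v) (S i) (w i) (benchCols h r j)).det =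
      (Matrix.of fun i j : Fin r => dirE P (S i) (w i) (benchCols h r j)).det := by
  rw [matrix_shiftT hr P v S w W hW, Matrix.det_mul, det_shiftU hr, mul_one]

end Codes

end Summit.ValiantsHypothesis.ValiantsHypothesis.Theorems.BarrierLever.ChowBenchmarkSplit
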